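import Literature.MathematicalPhysics.QuantumFieldTheory.Balaban1983to89.B1Eq324BenfattoSect5SlotMoments
import Literature.MathematicalPhysics.QuantumFieldTheory.Balaban1983to89.B1Eq324BenfattoSect5CondToFree
import HarnessLib

/-!
# `Balaban1983to89.B1Eq324BenfattoSect5PolyClusters` — [BenfattoEtAl1978] §5 pp. 157–158, (5.29) second term / (5.31) «(error)»
# FOR POLYNOMIAL SLOTS: the joint truncated expectations of polynomial slots `Z_j = Σ_c a_{jc} Π_{l∈J_{jc}} z(x_{jcl})` under
# `P̄(dz|z̄_Γ)` expand over COLOURINGS into monomial clusters (multilinearity), to which n08-b's monomial-cluster theorems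
# (Appendix D clustering `…AppendixDWick`, the conditioned-versus-free comparison `…Sect5CondToFree`) apply BY NAME — PROVED

statement-level skeleton of published theorems with citation tags; proofs where landed; nothing here is a claim about the
Yang–Mills mass gap

WHY THIS MODULE (cell `pub-ymgap`, seat `dag-n08-c`, node N08; «the NEXT layer» named by n08-b g5's `…Sect5PerBox` decl list: the
per-colouring hypotheses `|U_χ(f)| ≤ δ₂₉` / `|U_χ(f) − u₀(f)| ≤ δ₃₁` of the per-box relation are to be discharged on `condField` by
`…ChiToOne` / `…AppendixD*` / `…CondToFree` / `…SlotMoments`).  Print (p. 158): the second term of (5.29) comes *"from the properties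
of the conditioned measure and from the Wick theorem (see Appendix D)"* and the error of (5.31) *"can be studied along the same lines
of the argument leading to the bound (5.30) and has the same form of (5.29) with new constants"*; p. 153: *"𝓔^T_z̄ … are polynomials
in the z̄ and differ very little from the … unconditional ones"*.  In the tree both statements exist for MONOMIAL clusters, in p13's
leg/diagram currency `ursellOf (V ↦ ∫Π_{l∈legs own V} z(x_l) dμ) (allV σ)` (`B1Eq324BenfattoAppendixDWick.abs_ursellOf_condField_monomials_le_exp`,
`B1Eq324BenfattoSect5CondToFree.abs_ursellOf_condField_sub_P0_le`); the per-box algebra (`…Sect5PerBox`, `…Sect5JointCumulants`) speaks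
the slot currency `ursellOf (P ↦ ∫Π_{j∈P} Y_j dμ) univ`.  This file (1) proves the homogeneity of the Ursell function in all its
arguments, (2) builds the BRIDGE between the two currencies (legs `Λ = Σ j, J_j`, `own = Sigma.fst`), (3) expands polynomial slots
over colourings (n08-b's `…Sect5ChiToOne.ursellOf_moment_sum_eq_sum_of_moments` BY NAME, the integrability from
`…Sect5SlotMoments`), and (4)–(5) lifts the two monomial-cluster theorems to polynomial slots; the corridor GEOMETRY that makes the
per-colouring quantities uniform (distances `□′∖Γ₄ ↔ Γ₂ ≥ b^{3/2}/2`, `ε` from (C.7)+(C.2)) is the boxes line's and stays displayed.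

WHAT IS PROVED (theorems only; no definition, no named fact, no `sorry`; axioms standard).
* §1 `ursellOf_prod_mul` — `(P ↦ (Π_{j∈P} c_j)·m(P))ᵀ(V) = (Π_{j∈V} c_j)·mᵀ(V)` (strong induction on the Möbius recursion
  `LatticeModels.ursellOf_eq`; `IsSetPartition.biUnion_id`).
* §2 THE BRIDGE: `legs_sigma_eq`, `prod_legs_sigma_eq`, ★ `ursellOf_legs_sigma_eq` — with `Λ = (j : σ) × ↥(J_j)`, `own = Sigma.fst`,
  `ursellOf (V ↦ ∫Π_{l∈legs own V} X_{l.1 l.2} dμ) (allV σ) = ursellOf (P ↦ ∫Π_{j∈P}Π_{l∈J_j} X_{jl} dμ) univ` (`ursellOf_map some`,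
  `prod_sigma`).
* §3 ★ `ursellOf_poly_eq_sum_colourings` — `𝓔^T(Z₁,…,Z_k) = Σ_{f : σ → ι} (Π_j a_{j f(j)})·𝓔^T(mono_{1,f(1)},…,mono_{k,f(k)})` for slots
  `Z_j = Σ_c a_{jc}·mono_{jc}` with integrable monomial powers; `abs_ursellOf_poly_le_of_colourings` (`|𝓔^T(Z)| ≤ Σ_f (Π_j|a_{jf(j)}|)·B_f`),
  `sum_prod_abs_eq_prod_sum` (`Σ_f Π_j|a_{jf(j)}| = Π_j Σ_c|a_{jc}|`), `abs_ursellOf_poly_le_of_uniform` (`≤ (Π_jΣ_c|a_{jc}|)·B`).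
* §4 APPENDIX D FOR POLYNOMIAL SLOTS under `P̄`: `sum_filter_sameOwner_sigma_eq` (the intra-cluster sum in slot coordinates), `card_sigma_coe`
  (`|Λ| = Σ_j|J_j|`), `integrable_abs_monomial_pow_condField` / `measurable_monomial` (the monomials' integrability, one-term case of
  `…SlotMoments.integrable_abs_poly_eval_pow_condField`), ★ `abs_ursellOf_monomials_condField_le_exp` (n08-b's App. D bound in the SLOT currency, one family of monomials, pseudo-distance on
  tesserae, designated legs displayed), ★★ `abs_ursellOf_poly_condField_le_exp` (polynomial slots: the colouring sum of the per-cluster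
  App. D bounds, weighted by `Π_j|a_{jf(j)}|`).
* §5 (5.31) FOR POLYNOMIAL SLOTS: ★ `abs_ursellOf_monomials_condField_sub_P0_le` (slot currency), `abs_ursellOf_poly_sub_le_of_colourings`
  (two measures, colouring by colouring), `condFreeConst_mono`, ★★ `abs_ursellOf_poly_condField_sub_P0_le`
  (`|𝓔^T_{z̄}(Z) − 𝓔^T_0(Z)| ≤ (Π_jΣ_c|a_{jc}|)·2^{N}2^{2^{N}}·N·R^{N}·ε`, `N = kq`, uniform leg-wise `ε`, `R`).

HONEST SCOPE / NOT HERE.  The weights `χ` are already removed (`…SlotMoments` §6 / `…ChiToOneOnData`); the uniformisation of the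
per-colouring exponents (the geometry of the corridors, the decay `e^{−(ϰ/2)d(Δ)}` of the coefficients against the intra-cluster sum)
and the collection into `δ₂₉`, `δ₃₁` with print's «new constants» are the boxes line's / the assembly's; `BasicLemmaPrinted` stays OPEN.
NOT summit progress; count-neutral for N08; nothing of [Balaban1985UV3] is asserted.
-/

open Finset MeasureTheory
open scoped BigOperators

namespace Literature.MathematicalPhysics.QuantumFieldTheory.Balaban1983to89.B1Eq324BenfattoSect5PolyClusters

open _root_.MeasureTheory _root_.ProbabilityTheory
open Literature.Probability.LatticeModels (setPartitions IsSetPartition mem_setPartitions ursellOf ursellOf_eq ursellOf_map)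
open Literature.Probability.LatticeModels.LegDiagram (legs mem_legs)
open Literature.MathematicalPhysics.QuantumFieldTheory
open Literature.MathematicalPhysics.QuantumFieldTheory.Balaban1983to89.B1Eq323ConnectedGraphBound (allV)
open Literature.MathematicalPhysics.QuantumFieldTheory.Balaban1983to89.B1Eq324GaussianMomentLeaf (poly)
open Literature.MathematicalPhysics.QuantumFieldTheory.Balaban1983to89.B1Eq324BenfattoLemma
open Literature.MathematicalPhysics.QuantumFieldTheory.Balaban1983to89.B1Eq324BenfattoMarkov (isProbabilityMeasure_condField)
open Literature.MathematicalPhysics.QuantumFieldTheory.Balaban1983to89.B1Eq324BenfattoSect5ChiToOne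
  (ursellOf_moment_sum_eq_sum_of_moments)
open Literature.MathematicalPhysics.QuantumFieldTheory.Balaban1983to89.B1Eq324BenfattoSect5SlotMoments
  (measurable_poly_eval integrable_abs_poly_eval_pow_condField)
open Literature.MathematicalPhysics.QuantumFieldTheory.Balaban1983to89.B1Eq324BenfattoAppendixDWick
  (abs_ursellOf_condField_monomials_le_exp)
open Literature.MathematicalPhysics.QuantumFieldTheory.Balaban1983to89.B1Eq324BenfattoSect5CondToFree
  (abs_ursellOf_condField_sub_P0_le)

/-! ## §1  Homogeneity of the Ursell function in all its arguments -/

section Homogeneity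

variable {α : Type*} [DecidableEq α] {C : Type*} [CommRing C]

/-- **Homogeneity in all arguments**: scaling the set function by `Π_{j∈P} c_j` scales its Ursell function on `V` by `Π_{j∈V} c_j`
(every block product of a set partition of `V` reassembles `Π_{j∈V} c_j`). [cite: BenfattoEtAl1978, (2.7) p.147] -/
theorem ursellOf_prod_mul (c : α → C) (m : Finset α → C) (V : Finset α) :
    ursellOf (fun P => (∏ j ∈ P, c j) * m P) V = (∏ j ∈ V, c j) * ursellOf m V := by
  induction V using Finset.strongInduction with
  | H V ih =>
    rw [ursellOf_eq, ursellOf_eq m V, mul_sub, Finset.mul_sum]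
    congr 1
    refine Finset.sum_congr rfl fun π hπ => ?_
    obtain ⟨hne, hπ'⟩ := Finset.mem_erase.1 hπ
    have hsp : IsSetPartition V π := mem_setPartitions.1 hπ'
    rw [Finset.prod_congr rfl fun P hP => ih P (hsp.ssubset_of_ne_singleton hne hP), Finset.prod_mul_distrib]
    congr 1
    calc ∏ P ∈ π, ∏ j ∈ P, c j = ∏ j ∈ π.biUnion id, c j := (Finset.prod_biUnion hsp.pairwiseDisjoint).symm
      _ = ∏ j ∈ V, c j := by rw [hsp.biUnion_id]

end Homogeneity

/-! ## §2  The bridge: p13's leg/cluster currency versus the slot currency -/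

section Bridge

variable {Ω : Type*} {mΩ : MeasurableSpace Ω} (μ : Measure Ω)
variable {σ : Type} [Fintype σ] [DecidableEq σ] {κ : Type} (Jm : σ → Finset κ)

/-- The legs of the clusters `P` in the sigma encoding `Λ = (j : σ) × ↥(J_j)`, `own = Sigma.fst`: all legs over `j ∈ P`.
[cite: BenfattoEtAl1978, (2.7) p.147] -/
theorem legs_sigma_eq (P : Finset σ) :
    legs (Sigma.fst : ((j : σ) × ↥(Jm j)) → σ) (P.map Function.Embedding.some) =
      P.sigma fun j => (Finset.univ : Finset ↥(Jm j)) := by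
  ext l
  simp only [mem_legs, Finset.mem_map, Function.Embedding.some_apply, Option.some.injEq, exists_eq_right,
    Finset.mem_sigma, Finset.mem_univ, and_true]

/-- The leg product of the clusters `P` is the product over `j ∈ P` of the monomials `Π_{l∈J_j} X_{jl}`.
[cite: BenfattoEtAl1978, (2.7) p.147] -/
theorem prod_legs_sigma_eq (X : σ → κ → Ω → ℝ) (P : Finset σ) (ω : Ω) :
    ∏ l ∈ legs (Sigma.fst : ((j : σ) × ↥(Jm j)) → σ) (P.map Function.Embedding.some), X l.1 l.2 ω =
      ∏ j ∈ P, ∏ l ∈ Jm j, X j l ω := by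
  rw [legs_sigma_eq, Finset.prod_sigma]
  refine Finset.prod_congr rfl fun j _ => ?_
  exact Finset.prod_coe_sort (Jm j) (fun l => X j l ω)

/-- **THE BRIDGE**: the joint truncated expectation of the monomial clusters `Π_{l∈J_j} X_{jl}`, `j ∈ σ`, written in p13's leg currency
(`ursellOf (V ↦ ∫Π_{l∈legs own V} …) (allV σ)`, `Λ = (j : σ) × ↥(J_j)`, `own = Sigma.fst`) EQUALS the one written in the slot currency
(`ursellOf (P ↦ ∫Π_{j∈P}Π_{l∈J_j} X_{jl} dμ) univ`) — `ursellOf_map` along `some`. [cite: BenfattoEtAl1978, (2.7) p.147] -/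
theorem ursellOf_legs_sigma_eq (X : σ → κ → Ω → ℝ) :
    ursellOf (fun V : Finset (Option σ) =>
        ∫ ω, ∏ l ∈ legs (Sigma.fst : ((j : σ) × ↥(Jm j)) → σ) V, X l.1 l.2 ω ∂μ) (allV σ) =
      ursellOf (fun P : Finset σ => ∫ ω, ∏ j ∈ P, ∏ l ∈ Jm j, X j l ω ∂μ) Finset.univ := by
  rw [allV, ← ursellOf_map]
  congr 1
  funext P
  simp_rw [prod_legs_sigma_eq]

end Bridge

/-! ## §3  Polynomial slots expand over colourings into monomial clusters -/

section Colourings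

variable {Ω : Type*} {mΩ : MeasurableSpace Ω} {μ : Measure Ω} [IsFiniteMeasure μ]
variable {σ : Type*} [Fintype σ] [DecidableEq σ] [Nonempty σ] {ι : Type*} [Fintype ι] [Nonempty ι]

/-- **MULTILINEARITY FOR POLYNOMIAL SLOTS**: for slots `Z_j = Σ_c a_{jc}·mono_{jc}` whose monomials have integrable absolute powers
`p ≤ k`, `𝓔^T(Z₁,…,Z_k) = Σ_{f : σ → ι} (Π_j a_{j f(j)}) · 𝓔^T(mono_{1,f(1)},…,mono_{k,f(k)})` — n08-b's
`…Sect5ChiToOne.ursellOf_moment_sum_eq_sum_of_moments` and the homogeneity `ursellOf_prod_mul`. [cite: BenfattoEtAl1978, (5.25) p.157 and (5.31) p.158] -/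
theorem ursellOf_poly_eq_sum_colourings (a : σ → ι → ℝ) (mono : σ → ι → Ω → ℝ)
    (hm : ∀ j c, AEStronglyMeasurable (mono j c) μ)
    (hint : ∀ j c (p : ℕ), p ≤ Fintype.card σ → Integrable (fun ω => |mono j c ω| ^ p) μ) :
    ursellOf (fun P : Finset σ => ∫ ω, ∏ j ∈ P, (∑ c, a j c * mono j c ω) ∂μ) Finset.univ =
      ∑ f : σ → ι, (∏ j, a j (f j)) *
        ursellOf (fun P : Finset σ => ∫ ω, ∏ j ∈ P, mono j (f j) ω ∂μ) Finset.univ := by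
  have hWm : ∀ c j, AEStronglyMeasurable (fun ω => a j c * mono j c ω) μ := fun c j => (hm j c).const_mul _
  have hWint : ∀ c j (p : ℕ), p ≤ Fintype.card σ → Integrable (fun ω => |a j c * mono j c ω| ^ p) μ := by
    intro c j p hp
    refine ((hint j c p hp).const_mul (|a j c| ^ p)).congr (ae_of_all _ fun ω => ?_)
    simp only [abs_mul, mul_pow]
  rw [ursellOf_moment_sum_eq_sum_of_moments (W := fun c j ω => a j c * mono j c ω) hWm hWint]
  refine Finset.sum_congr rfl fun f _ => ?_
  rw [← ursellOf_prod_mul]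
  congr 1
  funext P
  rw [← integral_const_mul]
  refine integral_congr_ae (ae_of_all _ fun ω => ?_)
  simp only [Finset.prod_mul_distrib]

/-- **`|𝓔^T(Z)| ≤ Σ_f (Π_j|a_{jf(j)}|)·B_f`** for per-colouring bounds `B_f` on the monomial clusters.
[cite: BenfattoEtAl1978, (5.29) p.158 and (5.31) p.158] -/
theorem abs_ursellOf_poly_le_of_colourings (a : σ → ι → ℝ) (mono : σ → ι → Ω → ℝ)
    (hm : ∀ j c, AEStronglyMeasurable (mono j c) μ)
    (hint : ∀ j c (p : ℕ), p ≤ Fintype.card σ → Integrable (fun ω => |mono j c ω| ^ p) μ) (B : (σ → ι) → ℝ)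
    (hB : ∀ f : σ → ι, |ursellOf (fun P : Finset σ => ∫ ω, ∏ j ∈ P, mono j (f j) ω ∂μ) Finset.univ| ≤ B f) :
    |ursellOf (fun P : Finset σ => ∫ ω, ∏ j ∈ P, (∑ c, a j c * mono j c ω) ∂μ) Finset.univ| ≤
      ∑ f : σ → ι, (∏ j, |a j (f j)|) * B f := by
  rw [ursellOf_poly_eq_sum_colourings a mono hm hint]
  refine (Finset.abs_sum_le_sum_abs _ _).trans (Finset.sum_le_sum fun f _ => ?_)
  rw [abs_mul, Finset.abs_prod]
  exact mul_le_mul_of_nonneg_left (hB f) (Finset.prod_nonneg fun j _ => abs_nonneg _)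

omit [Nonempty σ] [Nonempty ι] in
/-- `Σ_{f : σ → ι} Π_j |a_{j f(j)}| = Π_j Σ_c |a_{jc}|` (`Fintype.prod_sum`). [cite: BenfattoEtAl1978, (5.25) p.157] -/
theorem sum_prod_abs_eq_prod_sum (a : σ → ι → ℝ) :
    ∑ f : σ → ι, ∏ j, |a j (f j)| = ∏ j, ∑ c, |a j c| :=
  (Fintype.prod_sum fun j c => |a j c|).symm

/-- **`|𝓔^T(Z)| ≤ (Π_j Σ_c|a_{jc}|)·B`** for a UNIFORM bound `B` on the monomial clusters of all colourings.
[cite: BenfattoEtAl1978, (5.29) p.158 and (5.31) p.158] -/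
theorem abs_ursellOf_poly_le_of_uniform (a : σ → ι → ℝ) (mono : σ → ι → Ω → ℝ)
    (hm : ∀ j c, AEStronglyMeasurable (mono j c) μ)
    (hint : ∀ j c (p : ℕ), p ≤ Fintype.card σ → Integrable (fun ω => |mono j c ω| ^ p) μ) {B : ℝ}
    (hB : ∀ f : σ → ι, |ursellOf (fun P : Finset σ => ∫ ω, ∏ j ∈ P, mono j (f j) ω ∂μ) Finset.univ| ≤ B) :
    |ursellOf (fun P : Finset σ => ∫ ω, ∏ j ∈ P, (∑ c, a j c * mono j c ω) ∂μ) Finset.univ| ≤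
      (∏ j, ∑ c, |a j c|) * B := by
  refine (abs_ursellOf_poly_le_of_colourings a mono hm hint (fun _ => B) fun f => hB f).trans (le_of_eq ?_)
  rw [← Finset.sum_mul, sum_prod_abs_eq_prod_sum]

end Colourings

/-! ## §4  Appendix D for polynomial slots under the conditioned free field -/

section AppendixD

variable {d : ℕ} {α β : ℝ}
variable {σ : Type} [Fintype σ] [DecidableEq σ] [Nonempty σ] {κ : Type}

omit [Nonempty σ] in
/-- The intra-cluster sum of the sigma encoding in slot coordinates:
`Σ_{(a,b) : own a = own b} F(a,b) = Σ_j Σ_{l∈J_j} Σ_{l'∈J_j} F(j,l,j,l')`. [cite: BenfattoEtAl1978, Appendix D p.166] -/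
theorem sum_filter_sameOwner_sigma_eq (Jm : σ → Finset κ) (F : σ → κ → σ → κ → ℝ) :
    ∑ p ∈ (Finset.univ : Finset (((j : σ) × ↥(Jm j)) × ((j : σ) × ↥(Jm j)))).filter (fun p => p.1.1 = p.2.1),
        F p.1.1 p.1.2 p.2.1 p.2.2 =
      ∑ j, ∑ l ∈ Jm j, ∑ l' ∈ Jm j, F j l j l' := by
  rw [Finset.sum_filter, Fintype.sum_prod_type, Fintype.sum_sigma]
  refine Finset.sum_congr rfl fun j _ => ?_
  rw [← Finset.sum_coe_sort (Jm j)]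
  refine Finset.sum_congr rfl fun l _ => ?_
  rw [Fintype.sum_sigma, Finset.sum_eq_single j]
  · simp only [if_true]
    exact Finset.sum_coe_sort (Jm j) (fun l' => F j l j l')
  · intro j' _ hj'
    exact Finset.sum_eq_zero fun l' _ => if_neg (Ne.symm hj')
  · intro h
    exact absurd (Finset.mem_univ j) h

omit [DecidableEq σ] [Nonempty σ] in
/-- The leg count of the sigma encoding: `|Λ| = Σ_j |J_j|`. [cite: BenfattoEtAl1978, Appendix D p.166] -/
theorem card_sigma_coe (Jm : σ → Finset κ) : Fintype.card ((j : σ) × ↥(Jm j)) = ∑ j, (Jm j).card := by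
  simp only [Fintype.card_sigma, Fintype.card_coe]

/-- **APPENDIX D IN THE SLOT CURRENCY** — n08-b's `B1Eq324BenfattoAppendixDWick.abs_ursellOf_condField_monomials_le_exp` for ONE family
of monomials `Π_{l∈J_j} z(x_{jl})`, `j ∈ σ`, through the bridge of §2 (legs `Λ = (j : σ) × ↥(J_j)`, a linear order lifted from
`Fintype.equivFin`): with a pseudo-distance `ρ` on the tesserae, `|u(x_{jl})| ≤ K₀`, `|C^Γ(x_{jl}, x_{j'l'})| ≤ K₀e^{−δρ}` on the legs
(`K₀ ≥ 1`, `δ ≥ 0`) and two designated legs `l₁ ∈ J_{j₁}`, `l₂ ∈ J_{j₂}`,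
`|𝓔^T_{z̄}(Π_{l∈J_j} z(x_{jl}), j∈σ)| ≤ 2^{N}·2^{2^{N}}·K₀^{N}·exp(−(δ/2)(ρ(x_{j₁l₁}, x_{j₂l₂}) − Σ_jΣ_{l,l'∈J_j}ρ(x_{jl},x_{jl'})))`,
`N = Σ_j|J_j|`. [cite: BenfattoEtAl1978, Appendix D p.166] -/
theorem abs_ursellOf_monomials_condField_le_exp (hα : 0 < α) (hβ : 0 < β) (Γ : Finset (B1Eq324BenfattoLemma.Site d))
    (zbar : B1Eq324BenfattoLemma.Site d → ℝ) (Jm : σ → Finset κ) (xs : σ → κ → B1Eq324BenfattoLemma.Site d)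
    (ρ : B1Eq324BenfattoLemma.Site d → B1Eq324BenfattoLemma.Site d → ℝ) {K₀ δ : ℝ}
    (h0 : ∀ t, ρ t t = 0) (hsymm : ∀ t t', ρ t t' = ρ t' t) (htri : ∀ t t' t'', ρ t t'' ≤ ρ t t' + ρ t' t'')
    (hnn : ∀ t t', 0 ≤ ρ t t') (hK₀ : 1 ≤ K₀) (hδ : 0 ≤ δ)
    (hu : ∀ j, ∀ l ∈ Jm j, |condMean (freeCov d α β) Γ zbar (xs j l)| ≤ K₀)
    (hC : ∀ j j', ∀ l ∈ Jm j, ∀ l' ∈ Jm j',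
      |condCov (freeCov d α β) Γ (xs j l) (xs j' l')| ≤ K₀ * Real.exp (-(δ * ρ (xs j l) (xs j' l'))))
    {j₁ j₂ : σ} {l₁ l₂ : κ} (hl₁ : l₁ ∈ Jm j₁) (hl₂ : l₂ ∈ Jm j₂) :
    |ursellOf (fun P : Finset σ => ∫ z, ∏ j ∈ P, ∏ l ∈ Jm j, z (xs j l) ∂condField d α β Γ zbar) Finset.univ| ≤
      2 ^ (∑ j, (Jm j).card) * 2 ^ 2 ^ (∑ j, (Jm j).card) * (K₀ ^ (∑ j, (Jm j).card) *
        Real.exp (-(δ / 2 * (ρ (xs j₁ l₁) (xs j₂ l₂) -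
          ∑ j, ∑ l ∈ Jm j, ∑ l' ∈ Jm j, ρ (xs j l) (xs j l'))))) := by
  letI : LinearOrder ((j : σ) × ↥(Jm j)) :=
    LinearOrder.lift' (Fintype.equivFin ((j : σ) × ↥(Jm j))) (Fintype.equivFin _).injective
  have h := abs_ursellOf_condField_monomials_le_exp (Sigma.fst : ((j : σ) × ↥(Jm j)) → σ) hα hβ Γ zbar
    (fun a => xs a.1 a.2) (fun a b => ρ (xs a.1 a.2) (xs b.1 b.2)) (fun a => h0 _) (fun a b => hsymm _ _)
    (fun a b c => htri _ _ _) (fun a b => hnn _ _) hK₀ hδ (fun a => hu a.1 a.2 a.2.2)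
    (fun a b => hC a.1 b.1 a.2 a.2.2 b.2 b.2.2) ⟨j₁, ⟨l₁, hl₁⟩⟩ ⟨j₂, ⟨l₂, hl₂⟩⟩
  rw [ursellOf_legs_sigma_eq (condField d α β Γ zbar) Jm (fun j l (z : B1Eq324BenfattoLemma.Site d → ℝ) => z (xs j l)),
    card_sigma_coe, sum_filter_sameOwner_sigma_eq Jm (fun j l j' l' => ρ (xs j l) (xs j' l'))] at h
  exact h

/-- The monomials of the coordinates have `P̄`-integrable absolute powers (one-term case of
`B1Eq324BenfattoSect5SlotMoments.integrable_abs_poly_eval_pow_condField`). [cite: BenfattoEtAl1978, Appendix C 2) p.164] -/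
theorem integrable_abs_monomial_pow_condField (hα : 0 < α) (hβ : 0 < β) (Γ : Finset (B1Eq324BenfattoLemma.Site d))
    (zbar : B1Eq324BenfattoLemma.Site d → ℝ) (Jl : Finset κ) (x : κ → B1Eq324BenfattoLemma.Site d) (p : ℕ) :
    Integrable (fun z : B1Eq324BenfattoLemma.Site d → ℝ => |∏ l ∈ Jl, z (x l)| ^ p) (condField d α β Γ zbar) := by
  classical
  have h := integrable_abs_poly_eval_pow_condField hα hβ Γ zbar (Finset.univ : Finset Unit) (fun _ => Jl) (fun _ => (1 : ℝ))
    (fun _ l => x l) p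
  refine h.congr (ae_of_all _ fun z => ?_)
  simp only [poly, Finset.univ_unique, Finset.sum_singleton, one_mul]

/-- The monomials of the coordinates are measurable. [cite: BenfattoEtAl1978, Appendix C 2) p.164] -/
theorem measurable_monomial (Jl : Finset κ) (x : κ → B1Eq324BenfattoLemma.Site d) :
    Measurable fun z : B1Eq324BenfattoLemma.Site d → ℝ => ∏ l ∈ Jl, z (x l) :=
  Finset.measurable_prod Jl fun l _ => measurable_pi_apply (x l)

variable {ι : Type*} [Fintype ι] [Nonempty ι]

/-- **APPENDIX D FOR POLYNOMIAL SLOTS** (the second term of (5.29) before the geometry): for slots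
`Z_j = Σ_c a_{jc} Π_{l∈J_{jc}} z(x_{jcl})` under `P̄`, with the leg hypotheses of `abs_ursellOf_monomials_condField_le_exp` for every
colouring `f` and designated legs `l₁(f) ∈ J_{j₁ f(j₁)}`, `l₂(f) ∈ J_{j₂ f(j₂)}`,
`|𝓔^T_{z̄}(Z₁,…,Z_k)| ≤ Σ_f (Π_j|a_{jf(j)}|)·2^{N_f}2^{2^{N_f}}K₀^{N_f}·exp(−(δ/2)(ρ(x_{j₁f l₁(f)}, x_{j₂f l₂(f)}) − intra_f))`.
The uniformisation of the exponent over `f` is the corridor geometry (boxes line). [cite: BenfattoEtAl1978, (5.29) p.158 and Appendix D p.166] -/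
theorem abs_ursellOf_poly_condField_le_exp (hα : 0 < α) (hβ : 0 < β) (Γ : Finset (B1Eq324BenfattoLemma.Site d))
    (zbar : B1Eq324BenfattoLemma.Site d → ℝ) (a : σ → ι → ℝ) (Jm : σ → ι → Finset κ)
    (xs : σ → ι → κ → B1Eq324BenfattoLemma.Site d)
    (ρ : B1Eq324BenfattoLemma.Site d → B1Eq324BenfattoLemma.Site d → ℝ) {K₀ δ : ℝ}
    (h0 : ∀ t, ρ t t = 0) (hsymm : ∀ t t', ρ t t' = ρ t' t) (htri : ∀ t t' t'', ρ t t'' ≤ ρ t t' + ρ t' t'')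
    (hnn : ∀ t t', 0 ≤ ρ t t') (hK₀ : 1 ≤ K₀) (hδ : 0 ≤ δ)
    (hu : ∀ j c, ∀ l ∈ Jm j c, |condMean (freeCov d α β) Γ zbar (xs j c l)| ≤ K₀)
    (hC : ∀ j c j' c', ∀ l ∈ Jm j c, ∀ l' ∈ Jm j' c',
      |condCov (freeCov d α β) Γ (xs j c l) (xs j' c' l')| ≤ K₀ * Real.exp (-(δ * ρ (xs j c l) (xs j' c' l'))))
    (j₁ j₂ : σ) (l₁ l₂ : (σ → ι) → κ) (hl₁ : ∀ f, l₁ f ∈ Jm j₁ (f j₁)) (hl₂ : ∀ f, l₂ f ∈ Jm j₂ (f j₂)) :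
    |ursellOf (fun P : Finset σ => ∫ z, ∏ j ∈ P, (∑ c, a j c * ∏ l ∈ Jm j c, z (xs j c l)) ∂condField d α β Γ zbar)
        Finset.univ| ≤
      ∑ f : σ → ι, (∏ j, |a j (f j)|) *
        (2 ^ (∑ j, (Jm j (f j)).card) * 2 ^ 2 ^ (∑ j, (Jm j (f j)).card) * (K₀ ^ (∑ j, (Jm j (f j)).card) *
          Real.exp (-(δ / 2 * (ρ (xs j₁ (f j₁) (l₁ f)) (xs j₂ (f j₂) (l₂ f)) -
            ∑ j, ∑ l ∈ Jm j (f j), ∑ l' ∈ Jm j (f j), ρ (xs j (f j) l) (xs j (f j) l')))))) := by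
  haveI := isProbabilityMeasure_condField (d := d) hα hβ Γ zbar
  refine abs_ursellOf_poly_le_of_colourings a (fun j c (z : B1Eq324BenfattoLemma.Site d → ℝ) => ∏ l ∈ Jm j c, z (xs j c l))
    (fun j c => (measurable_monomial (Jm j c) (xs j c)).aestronglyMeasurable)
    (fun j c p _ => integrable_abs_monomial_pow_condField hα hβ Γ zbar (Jm j c) (xs j c) p) _ fun f => ?_
  exact abs_ursellOf_monomials_condField_le_exp hα hβ Γ zbar (fun j => Jm j (f j)) (fun j => xs j (f j)) ρ h0 hsymm htri hnn
    hK₀ hδ (fun j l hl => hu j (f j) l hl) (fun j j' l hl l' hl' => hC j (f j) j' (f j') l hl l' hl') (hl₁ f) (hl₂ f)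

end AppendixD

/-! ## §5  (5.31) «(error)» for polynomial slots: the conditioned versus the free truncated expectations -/

section CondFree

variable {d : ℕ} {α β : ℝ}
variable {σ : Type} [Fintype σ] [DecidableEq σ] [Nonempty σ] {κ : Type}

/-- **(5.31) IN THE SLOT CURRENCY** — n08-b's `B1Eq324BenfattoSect5CondToFree.abs_ursellOf_condField_sub_P0_le` for one family of
monomials through the bridge: leg-wise `|u| ≤ ε`, `|C^Γ − C| ≤ ε` and a-priori `|u|, |C^Γ|, |C| ≤ R` (`R ≥ 1`) give
`|𝓔^T_{z̄}(Π_{l∈J_j} z(x_{jl}), j∈σ) − 𝓔^T_0(…)| ≤ 2^{N}2^{2^{N}}·N·R^{N}·ε`, `N = Σ_j|J_j|`. [cite: BenfattoEtAl1978, (5.31) p.158] -/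
theorem abs_ursellOf_monomials_condField_sub_P0_le (hα : 0 < α) (hβ : 0 < β)
    (Γ : Finset (B1Eq324BenfattoLemma.Site d)) (zbar : B1Eq324BenfattoLemma.Site d → ℝ) (Jm : σ → Finset κ)
    (xs : σ → κ → B1Eq324BenfattoLemma.Site d) {R ε : ℝ} (hR : 1 ≤ R) (hε : 0 ≤ ε)
    (huR : ∀ j, ∀ l ∈ Jm j, |condMean (freeCov d α β) Γ zbar (xs j l)| ≤ R)
    (hCR : ∀ j j', ∀ l ∈ Jm j, ∀ l' ∈ Jm j', |condCov (freeCov d α β) Γ (xs j l) (xs j' l')| ≤ R)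
    (hGR : ∀ j j', ∀ l ∈ Jm j, ∀ l' ∈ Jm j', |freeCov d α β (xs j l) (xs j' l')| ≤ R)
    (huε : ∀ j, ∀ l ∈ Jm j, |condMean (freeCov d α β) Γ zbar (xs j l)| ≤ ε)
    (hCε : ∀ j j', ∀ l ∈ Jm j, ∀ l' ∈ Jm j',
      |condCov (freeCov d α β) Γ (xs j l) (xs j' l') - freeCov d α β (xs j l) (xs j' l')| ≤ ε) :
    |ursellOf (fun P : Finset σ => ∫ z, ∏ j ∈ P, ∏ l ∈ Jm j, z (xs j l) ∂condField d α β Γ zbar) Finset.univ -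
        ursellOf (fun P : Finset σ => ∫ z, ∏ j ∈ P, ∏ l ∈ Jm j, z (xs j l) ∂P0 d α β) Finset.univ| ≤
      2 ^ (∑ j, (Jm j).card) * 2 ^ 2 ^ (∑ j, (Jm j).card) *
        ((∑ j, (Jm j).card : ℕ) * R ^ (∑ j, (Jm j).card) * ε) := by
  letI : LinearOrder ((j : σ) × ↥(Jm j)) :=
    LinearOrder.lift' (Fintype.equivFin ((j : σ) × ↥(Jm j))) (Fintype.equivFin _).injective
  have h := abs_ursellOf_condField_sub_P0_le (Sigma.fst : ((j : σ) × ↥(Jm j)) → σ) hα hβ Γ zbar (fun a => xs a.1 a.2) hR hε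
    (fun a => huR a.1 a.2 a.2.2) (fun a b => hCR a.1 b.1 a.2 a.2.2 b.2 b.2.2) (fun a b => hGR a.1 b.1 a.2 a.2.2 b.2 b.2.2)
    (fun a => huε a.1 a.2 a.2.2) (fun a b => hCε a.1 b.1 a.2 a.2.2 b.2 b.2.2)
  rw [ursellOf_legs_sigma_eq (condField d α β Γ zbar) Jm (fun j l (z : B1Eq324BenfattoLemma.Site d → ℝ) => z (xs j l)),
    ursellOf_legs_sigma_eq (P0 d α β) Jm (fun j l (z : B1Eq324BenfattoLemma.Site d → ℝ) => z (xs j l)),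
    card_sigma_coe] at h
  exact h

variable {Ω : Type*} {mΩ : MeasurableSpace Ω} {μ μ' : Measure Ω} [IsFiniteMeasure μ] [IsFiniteMeasure μ']
variable {ι : Type*} [Fintype ι] [Nonempty ι]

/-- **Two measures, polynomial slots**: `|𝓔^T_μ(Z) − 𝓔^T_{μ'}(Z)| ≤ Σ_f (Π_j|a_{jf(j)}|)·B_f` for per-colouring bounds `B_f` on the
DIFFERENCE of the monomial clusters' truncated expectations (both sides expanded over the same colourings).
[cite: BenfattoEtAl1978, (5.31) p.158] -/
theorem abs_ursellOf_poly_sub_le_of_colourings (a : σ → ι → ℝ) (mono : σ → ι → Ω → ℝ)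
    (hm : ∀ j c, AEStronglyMeasurable (mono j c) μ) (hm' : ∀ j c, AEStronglyMeasurable (mono j c) μ')
    (hint : ∀ j c (p : ℕ), p ≤ Fintype.card σ → Integrable (fun ω => |mono j c ω| ^ p) μ)
    (hint' : ∀ j c (p : ℕ), p ≤ Fintype.card σ → Integrable (fun ω => |mono j c ω| ^ p) μ') (B : (σ → ι) → ℝ)
    (hB : ∀ f : σ → ι, |ursellOf (fun P : Finset σ => ∫ ω, ∏ j ∈ P, mono j (f j) ω ∂μ) Finset.univ -
      ursellOf (fun P : Finset σ => ∫ ω, ∏ j ∈ P, mono j (f j) ω ∂μ') Finset.univ| ≤ B f) :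
    |ursellOf (fun P : Finset σ => ∫ ω, ∏ j ∈ P, (∑ c, a j c * mono j c ω) ∂μ) Finset.univ -
        ursellOf (fun P : Finset σ => ∫ ω, ∏ j ∈ P, (∑ c, a j c * mono j c ω) ∂μ') Finset.univ| ≤
      ∑ f : σ → ι, (∏ j, |a j (f j)|) * B f := by
  rw [ursellOf_poly_eq_sum_colourings a mono hm hint, ursellOf_poly_eq_sum_colourings a mono hm' hint', ← Finset.sum_sub_distrib]
  refine (Finset.abs_sum_le_sum_abs _ _).trans (Finset.sum_le_sum fun f _ => ?_)
  rw [← mul_sub, abs_mul, Finset.abs_prod]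
  exact mul_le_mul_of_nonneg_left (hB f) (Finset.prod_nonneg fun j _ => abs_nonneg _)

/-- Monotonicity of the (5.31) constant `2^N 2^{2^N} N R^N ε` in the leg count `N` (`R ≥ 1`, `ε ≥ 0`).
[cite: BenfattoEtAl1978, (5.31) p.158] -/
theorem condFreeConst_mono {R ε : ℝ} (hR : 1 ≤ R) (hε : 0 ≤ ε) {N N' : ℕ} (h : N ≤ N') :
    (2 : ℝ) ^ N * 2 ^ 2 ^ N * ((N : ℝ) * R ^ N * ε) ≤ 2 ^ N' * 2 ^ 2 ^ N' * ((N' : ℝ) * R ^ N' * ε) := by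
  have h2 : (2 : ℝ) ^ N ≤ 2 ^ N' := pow_le_pow_right₀ one_le_two h
  have h22 : (2 : ℝ) ^ 2 ^ N ≤ 2 ^ 2 ^ N' := pow_le_pow_right₀ one_le_two (Nat.pow_le_pow_right two_pos h)
  have hRN : R ^ N ≤ R ^ N' := pow_le_pow_right₀ hR h
  have hNN : (N : ℝ) ≤ N' := by exact_mod_cast h
  have hR0 : 0 ≤ R ^ N := pow_nonneg (zero_le_one.trans hR) _
  gcongr

/-- **(5.31) «(error)» FOR POLYNOMIAL SLOTS**: for slots `Z_j = Σ_c a_{jc} Π_{l∈J_{jc}} z(x_{jcl})` of degree `≤ q` (`|J_{jc}| ≤ q`)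
whose legs all satisfy `|u| ≤ ε`, `|C^Γ − C| ≤ ε`, `|u|, |C^Γ|, |C| ≤ R` (`R ≥ 1`, `ε ≥ 0`),
`|𝓔^T_{z̄}(Z₁,…,Z_k) − 𝓔^T_0(Z₁,…,Z_k)| ≤ (Π_jΣ_c|a_{jc}|)·2^{N}2^{2^{N}}·N·R^{N}·ε`, `N = kq` — «the error can be studied along the
same lines … and has the same form of (5.29) with new constants»; the decay of `ε` with the distance from `Γ` is the boxes line's.
[cite: BenfattoEtAl1978, (5.31) p.158 and p.153] -/
theorem abs_ursellOf_poly_condField_sub_P0_le (hα : 0 < α) (hβ : 0 < β)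
    (Γ : Finset (B1Eq324BenfattoLemma.Site d)) (zbar : B1Eq324BenfattoLemma.Site d → ℝ) (a : σ → ι → ℝ)
    (Jm : σ → ι → Finset κ) (xs : σ → ι → κ → B1Eq324BenfattoLemma.Site d) {q : ℕ} (hq : ∀ j c, (Jm j c).card ≤ q)
    {R ε : ℝ} (hR : 1 ≤ R) (hε : 0 ≤ ε)
    (huR : ∀ j c, ∀ l ∈ Jm j c, |condMean (freeCov d α β) Γ zbar (xs j c l)| ≤ R)
    (hCR : ∀ j c j' c', ∀ l ∈ Jm j c, ∀ l' ∈ Jm j' c', |condCov (freeCov d α β) Γ (xs j c l) (xs j' c' l')| ≤ R)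
    (hGR : ∀ j c j' c', ∀ l ∈ Jm j c, ∀ l' ∈ Jm j' c', |freeCov d α β (xs j c l) (xs j' c' l')| ≤ R)
    (huε : ∀ j c, ∀ l ∈ Jm j c, |condMean (freeCov d α β) Γ zbar (xs j c l)| ≤ ε)
    (hCε : ∀ j c j' c', ∀ l ∈ Jm j c, ∀ l' ∈ Jm j' c',
      |condCov (freeCov d α β) Γ (xs j c l) (xs j' c' l') - freeCov d α β (xs j c l) (xs j' c' l')| ≤ ε) :
    |ursellOf (fun P : Finset σ => ∫ z, ∏ j ∈ P, (∑ c, a j c * ∏ l ∈ Jm j c, z (xs j c l)) ∂condField d α β Γ zbar)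
          Finset.univ -
        ursellOf (fun P : Finset σ => ∫ z, ∏ j ∈ P, (∑ c, a j c * ∏ l ∈ Jm j c, z (xs j c l)) ∂P0 d α β) Finset.univ| ≤
      (∏ j, ∑ c, |a j c|) * (2 ^ (Fintype.card σ * q) * 2 ^ 2 ^ (Fintype.card σ * q) *
        ((Fintype.card σ * q : ℕ) * R ^ (Fintype.card σ * q) * ε)) := by
  haveI := isProbabilityMeasure_condField (d := d) hα hβ Γ zbar
  haveI : IsProbabilityMeasure (P0 d α β) := isProbabilityMeasure_P0 hα hβ
  have hint0 : ∀ j c (p : ℕ), Integrable (fun z : B1Eq324BenfattoLemma.Site d → ℝ => |∏ l ∈ Jm j c, z (xs j c l)| ^ p)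
      (P0 d α β) := fun j c p => by
    rw [← condField_empty d α β zbar]
    exact integrable_abs_monomial_pow_condField hα hβ ∅ zbar (Jm j c) (xs j c) p
  set N := Fintype.card σ * q with hN
  have hNf : ∀ f : σ → ι, ∑ j, (Jm j (f j)).card ≤ N := fun f =>
    calc ∑ j, (Jm j (f j)).card ≤ ∑ _j : σ, q := Finset.sum_le_sum fun j _ => hq j (f j)
      _ = N := by rw [Finset.sum_const, smul_eq_mul, Finset.card_univ]
  refine (abs_ursellOf_poly_sub_le_of_colourings a (fun j c (z : B1Eq324BenfattoLemma.Site d → ℝ) => ∏ l ∈ Jm j c, z (xs j c l))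
    (fun j c => (measurable_monomial (Jm j c) (xs j c)).aestronglyMeasurable)
    (fun j c => (measurable_monomial (Jm j c) (xs j c)).aestronglyMeasurable)
    (fun j c p _ => integrable_abs_monomial_pow_condField hα hβ Γ zbar (Jm j c) (xs j c) p) (fun j c p _ => hint0 j c p)
    (fun _ => (2 : ℝ) ^ N * 2 ^ 2 ^ N * ((N : ℝ) * R ^ N * ε))
    fun f => (abs_ursellOf_monomials_condField_sub_P0_le hα hβ Γ zbar (fun j => Jm j (f j)) (fun j => xs j (f j)) hR hε
      (fun j l hl => huR j (f j) l hl) (fun j j' l hl l' hl' => hCR j (f j) j' (f j') l hl l' hl')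
      (fun j j' l hl l' hl' => hGR j (f j) j' (f j') l hl l' hl') (fun j l hl => huε j (f j) l hl)
      (fun j j' l hl l' hl' => hCε j (f j) j' (f j') l hl l' hl')).trans
      (condFreeConst_mono hR hε (hNf f))).trans (le_of_eq ?_)
  rw [← Finset.sum_mul, sum_prod_abs_eq_prod_sum]

end CondFree

end Literature.MathematicalPhysics.QuantumFieldTheory.Balaban1983to89.B1Eq324BenfattoSect5PolyClusters
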